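import Mathlib.AlgebraicGeometry.EllipticCurve.Affine.Point
import Mathlib.GroupTheory.Torsion
import Mathlib.LinearAlgebra.Dimension.Finrank
import Mathlib.LinearAlgebra.Dimension.Torsion.Basic
import Mathlib.LinearAlgebra.Isomorphisms
import Mathlib.LinearAlgebra.FreeModule.PID
import Mathlib.NumberTheory.NumberField.Basic
import HarnessLib

-- provenance: harness21/H21/H21/Prelude/TranscendEllArithS/MordellWeil.lean @ efa73f9 (interim HEAD d8f2665); M5 mechanical rewrite
/-!
# Mordell–Weil rank vocabulary (trunk T-ELLARITH, G06 TranscendEllArithS, item C10)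

For a Weierstrass curve `W` over a field `K`, Mathlib provides the group of `K`-rational points
`W.toAffine.Point` with its `AddCommGroup` structure (`Mathlib.AlgebraicGeometry.EllipticCurve.
Affine.Point`; the point at infinity is `0`). This file fixes the vocabulary of the Mordell–Weil
theorem used throughout the BSD statement files:

* `WeierstrassCurve.mordellWeilRank W = rank_ℤ E(K)`, defined as `Module.finrank ℤ E(K)`;
* `WeierstrassCurve.torsionOrder W = #E(K)_tors`, with `E(K)_tors = AddCommGroup.torsion E(K)`
  (Mathlib);
* `WeierstrassCurve.mordellWeilModTorsion W = E(K) / E(K)_tors` (a torsion-free abelian group, by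
  Mathlib's `QuotientAddGroup.instIsAddTorsionFree`);
* `WeierstrassCurve.IsMordellWeilBasis W P`: the family `P : ι → E(K)` maps to a `ℤ`-basis of
  `E(K) / E(K)_tors`;
* the Mordell–Weil theorem over number fields (`module_finite_point`, `addGroup_fg_point`;
  Mordell 1922, Weil 1929; Silverman, *The Arithmetic of Elliptic Curves* (AEC), Thm VIII.6.7) and
  its standard consequences (finiteness of torsion, freeness of `E(K)/tors`, existence of a
  Mordell–Weil basis, `rank = 0 ↔ E(K)` finite). Proofs are `sorry` (known theorems in print).

## Mathlib search

Mathlib (pin v4.32.0) has no Mordell–Weil theorem and no named rank of an elliptic curve; it has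
`AddCommGroup.torsion`, `AddCommGroup.freeRank` (`Mathlib.GroupTheory.Torsion`), `Module.finrank`,
`Module.Finite`, `AddGroup.FG`, and `Module.free_of_finite_type_torsion_free'`
(`Mathlib.LinearAlgebra.FreeModule.PID`), all of which are used here rather than redefined.

## Design choices

* Group rule of the outline (§0): the file is a `noncomputable section` with
  `open scoped Classical` and declares no `[DecidableEq K]` variable, so that the `AddCommGroup`
  instance on `W.toAffine.Point` is elaborated against the classical decidability instance, exactly
  as in the accepted `H21/Statements/BSD/Wave0.lean`.
* `mordellWeilRank` has the same name, type and body as `Literature.NumberTheory.EllipticCurves.mordellWeilRank` of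
  `H21/Statements/BSD/Wave0.lean` (the Wave0 copy is to be removed by the supervisor). It takes the
  junk value `0` when `E(K)` is not a finite `ℤ`-module (never the case over a number field).
* Declarations are placed in `namespace WeierstrassCurve` as a deliberate dot-notation extension of
  Mathlib's namespace (so that one writes `W.mordellWeilRank`, `W.torsionOrder`), as fixed by the
  architect's outline for all T-ELLARITH prelude files.
* The Mordell–Weil theorem here carries no inventory tag: the tagged statement **bsd.S04** lives in
  `H21/Statements/BSD/Wave0.lean`.
-/

noncomputable section

open scoped Classical

namespace WeierstrassCurve

variable {K : Type*} [Field K] (W : WeierstrassCurve K)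

section Defs

/-- The Mordell–Weil rank `rank_ℤ E(K)` of a Weierstrass curve `W` over a field `K`: the `ℤ`-rank
`Module.finrank ℤ E(K)` of the group of `K`-rational points (Silverman AEC VIII.6; junk value `0`
if `E(K)` is not a finitely generated abelian group, which does not happen over number fields by
the Mordell–Weil theorem `WeierstrassCurve.module_finite_point`). Same body as
`Literature.NumberTheory.EllipticCurves.mordellWeilRank` in `H21/Statements/BSD/Wave0.lean`. [folklore] -/
def mordellWeilRank : ℕ :=
  Module.finrank ℤ W.toAffine.Point

/-- The order `#E(K)_tors` of the torsion subgroup of the group of `K`-rational points of `W`, as a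
`Nat.card` (junk value `0` if the torsion subgroup is infinite; over a number field it is finite,
`WeierstrassCurve.finite_torsion`). Silverman AEC VII.3, VIII.6. [folklore] -/
def torsionOrder : ℕ :=
  Nat.card (AddCommGroup.torsion W.toAffine.Point)

/-- The free part `E(K) / E(K)_tors` of the Mordell–Weil group: the quotient of the group of
`K`-rational points by its torsion subgroup (Silverman AEC VIII.6; over a number field this is a
free abelian group of rank `rank_ℤ E(K)`). [folklore] -/
abbrev mordellWeilModTorsion : Type _ :=
  W.toAffine.Point ⧸ AddCommGroup.torsion W.toAffine.Point

/-- `E(K) / E(K)_tors` is an additive commutative group (Mathlib's quotient group structure).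
[folklore] -/
instance : AddCommGroup (mordellWeilModTorsion W) := inferInstance

/-- `E(K) / E(K)_tors` is torsion-free (Mathlib `QuotientAddGroup.instIsAddTorsionFree`).
[folklore] -/
instance : IsAddTorsionFree (mordellWeilModTorsion W) := inferInstance

/-- `E(K) / E(K)_tors` has no `ℤ`-zero-divisors, i.e. it is a torsion-free `ℤ`-module (from
`IsAddTorsionFree`). [folklore] -/
instance : NoZeroSMulDivisors ℤ (mordellWeilModTorsion W) := inferInstance

variable {W} in
/-- A family of points `P : ι → E(K)` is a *Mordell–Weil basis* of `W` if its image in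
`E(K) / E(K)_tors` is a `ℤ`-basis, i.e. is `ℤ`-linearly independent and spans
(Silverman AEC VIII.6; Cremona, *Algorithms for Modular Elliptic Curves* §3.5). Then every point of
`E(K)` is uniquely `∑ nᵢ Pᵢ + T` with `T` torsion. No finiteness of `ι` is assumed (over a
number field it follows, see `IsMordellWeilBasis.card_eq`). [folklore] -/
def IsMordellWeilBasis {ι : Type*} (P : ι → W.toAffine.Point) : Prop :=
  LinearIndependent ℤ (QuotientAddGroup.mk ∘ P : ι → mordellWeilModTorsion W) ∧
    Submodule.span ℤ (Set.range (QuotientAddGroup.mk ∘ P : ι → mordellWeilModTorsion W)) = ⊤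

end Defs

section NumberField

/- The named facts of this section quantify the hypotheses `[NumberField K] [W.IsElliptic]`
explicitly: a `Prop`-valued `def` would otherwise silently drop these (unused) instance variables
and over-generalise the vendored statements. -/
variable [NumberField K] [W.IsElliptic]

/-- The Mordell–Weil theorem, module form (Mordell 1922 over `ℚ`, bib `Mordell1922Rational`;
Weil 1929 over number fields, bib `Weil1929Arithmetique`; Silverman AEC Thm VIII.6.7):
for an elliptic curve `E` over a number field `K`, `E(K)` is a finite `ℤ`-module. (Untagged
prelude copy of `Literature.NumberTheory.EllipticCurves.module_finite_int_point`.) [cite: SilvermanAEC2009, Thm. VIII.6.7] -/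
def module_finite_point : Prop :=
  ∀ [NumberField K] [W.IsElliptic], Module.Finite ℤ W.toAffine.Point

/-- The Mordell–Weil theorem (Mordell 1922, Weil 1929; Silverman AEC Thm VIII.6.7): for an elliptic
curve `E` over a number field `K`, `E(K)` is a finitely generated abelian group (from the module
form, the named fact `module_finite_point`, hypothesis `h`).
[cite: SilvermanAEC2009, Thm. VIII.6.7] -/
theorem addGroup_fg_point (h : module_finite_point W) : AddGroup.FG W.toAffine.Point := by
  haveI : Module.Finite ℤ W.toAffine.Point := h
  exact (Module.Finite.iff_addGroup_fg).mp inferInstance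

/-- Over a number field the Mordell–Weil rank `finrank ℤ E(K)` agrees with Mathlib's free rank
`AddCommGroup.freeRank E(K) = rank (E(K) / E(K)_tors)` of the finitely generated abelian group
`E(K)` (structure theorem of f.g. abelian groups; Silverman AEC VIII.6). The finite generation
instance is supplied by the Mordell–Weil fact `module_finite_point` (binder `h`).
[cite: SilvermanAEC2009, VIII.6] -/
def mordellWeilRank_eq_freeRank : Prop :=
  ∀ [NumberField K] [W.IsElliptic] (h : module_finite_point W),
    haveI := addGroup_fg_point W h
    W.mordellWeilRank = AddCommGroup.freeRank W.toAffine.Point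

/-- Over a number field the torsion subgroup `E(K)_tors` is finite (Silverman AEC Cor. VIII.6.7.1;
also VII.3 via reduction). [cite: SilvermanAEC2009, Cor. VIII.6.7.1] -/
def finite_torsion : Prop :=
  ∀ [NumberField K] [W.IsElliptic], Finite (AddCommGroup.torsion W.toAffine.Point)

/-- Over a number field `#E(K)_tors ≥ 1` (the torsion subgroup is finite and contains `0`;
Silverman AEC VIII.6). Finiteness is the named fact `finite_torsion` (hypothesis `h`). [folklore] -/
theorem torsionOrder_pos (h : finite_torsion W) : 0 < W.torsionOrder := by
  haveI : Finite (AddCommGroup.torsion W.toAffine.Point) := h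
  exact Nat.card_pos

/-- Over a number field `E(K) / E(K)_tors` is a free `ℤ`-module (a finitely generated torsion-free
abelian group is free; Silverman AEC VIII.6, Mathlib `Module.free_of_finite_type_torsion_free'`).
Finite generation is the Mordell–Weil fact `module_finite_point` (hypothesis `h`). [folklore] -/
theorem module_free_mordellWeilModTorsion (h : module_finite_point W) :
    Module.Free ℤ (mordellWeilModTorsion W) := by
  haveI : Module.Finite ℤ W.toAffine.Point := h
  haveI : Module.Finite ℤ (mordellWeilModTorsion W) :=
    Module.Finite.of_surjective
      ((QuotientAddGroup.mk' (AddCommGroup.torsion W.toAffine.Point)).toIntLinearMap)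
      (QuotientAddGroup.mk'_surjective (AddCommGroup.torsion W.toAffine.Point))
  infer_instance

/-- Over a number field `rank_ℤ (E(K) / E(K)_tors) = rank_ℤ E(K)` (Silverman AEC VIII.6).
[cite: SilvermanAEC2009, VIII.6] -/
def finrank_mordellWeilModTorsion_eq : Prop :=
  ∀ [NumberField K] [W.IsElliptic], Module.finrank ℤ (mordellWeilModTorsion W) = W.mordellWeilRank

/-- Over a number field an elliptic curve admits a Mordell–Weil basis `P₁, …, P_r`,
`r = rank_ℤ E(K)` (Silverman AEC VIII.6; Cremona §3.5). [cite: SilvermanAEC2009, VIII.6] -/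
def exists_isMordellWeilBasis : Prop :=
  ∀ [NumberField K] [W.IsElliptic],
    ∃ P : Fin W.mordellWeilRank → W.toAffine.Point, IsMordellWeilBasis P

variable {W} in
/-- Any Mordell–Weil basis of an elliptic curve over a number field has `rank_ℤ E(K)` elements
(invariance of rank of a free `ℤ`-module; Silverman AEC VIII.6). [cite: SilvermanAEC2009, VIII.6] -/
def IsMordellWeilBasis.card_eq : Prop :=
  ∀ [NumberField K] [W.IsElliptic] {ι : Type*} [Fintype ι] {P : ι → W.toAffine.Point},
    IsMordellWeilBasis P → Fintype.card ι = W.mordellWeilRank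

/-- Over a number field, `rank_ℤ E(K) = 0` if and only if `E(K)` is finite (Mordell–Weil plus the
structure theorem; Silverman AEC VIII.6). [cite: SilvermanAEC2009, VIII.6] -/
def mordellWeilRank_eq_zero_iff : Prop :=
  ∀ [NumberField K] [W.IsElliptic], W.mordellWeilRank = 0 ↔ Finite W.toAffine.Point

end NumberField

section Discharges

/-! ### Discharged facts

The two rank facts below are pure linear algebra over `ℤ` and hold for every Weierstrass curve
over every field (no Mordell–Weil input): `rank_ℤ (M ⧸ M_tors) = rank_ℤ M` for any abelian
group `M` (Mathlib `finrank_quotient_eq_of_le_torsion`), and any `ℤ`-basis of the free module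
`M ⧸ M_tors` indexed by a `Fintype ι` has `finrank` elements (invariance of rank,
`Module.finrank_eq_card_basis`). This is the algebra behind "`E(K) ≅ E(K)_tors × ℤ^r`, `r` the
rank" in Silverman AEC, Ch. VIII intro and §VIII.6 (Thm. VIII.6.7). The theorems are stated
outside the `NumberField` section so that they close the named facts with no extra instance
hypotheses. -/

/-- Discharge of the named fact `finrank_mordellWeilModTorsion_eq`:
`rank_ℤ (E(K) / E(K)_tors) = rank_ℤ E(K)`. Proof: the quotient map `E(K) → E(K)/E(K)_tors` is a
surjective `ℤ`-linear map whose kernel, the torsion subgroup, lies in the `ℤ`-torsion submodule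
(`Submodule.torsion_int`); conclude by the first isomorphism theorem and Mathlib's
`finrank_quotient_eq_of_le_torsion`. Holds over any field `K`. [cite: SilvermanAEC2009, VIII.6] -/
theorem finrank_mordellWeilModTorsion_eq_holds : finrank_mordellWeilModTorsion_eq W := by
  intro _ _
  let f : W.toAffine.Point →ₗ[ℤ] mordellWeilModTorsion W :=
    (QuotientAddGroup.mk' (AddCommGroup.torsion W.toAffine.Point)).toIntLinearMap
  have hf : Function.Surjective f :=
    QuotientAddGroup.mk'_surjective (AddCommGroup.torsion W.toAffine.Point)
  have hker : LinearMap.ker f ≤ Submodule.torsion ℤ W.toAffine.Point := by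
    intro x hx
    have hx' : x ∈ AddCommGroup.torsion W.toAffine.Point :=
      (QuotientAddGroup.eq_zero_iff x).mp (LinearMap.mem_ker.mp hx)
    rwa [← Submodule.torsion_int] at hx'
  rw [mordellWeilRank, ← (f.quotKerEquivOfSurjective hf).finrank_eq]
  exact finrank_quotient_eq_of_le_torsion hker

variable {W} in
/-- Discharge of the named fact `IsMordellWeilBasis.card_eq`: any Mordell–Weil basis indexed by a
finite type `ι` has `Fintype.card ι = rank_ℤ E(K)`. Proof: the images of the `Pᵢ` form a `ℤ`-basis
of `E(K)/E(K)_tors` (`Module.Basis.mk`), so `card ι = finrank ℤ (E(K)/E(K)_tors)`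
(`Module.finrank_eq_card_basis`, invariance of rank over the commutative ring `ℤ`), which equals
`rank_ℤ E(K)` by `finrank_mordellWeilModTorsion_eq_holds`. Holds over any field `K`; this is the
well-definedness of the rank `r` in `E(K) ≅ E(K)_tors × ℤ^r` (Silverman AEC, introduction to
Ch. VIII and Thm. VIII.6.7). [cite: SilvermanAEC2009, VIII.6] -/
theorem IsMordellWeilBasis.card_eq_holds : IsMordellWeilBasis.card_eq (W := W) := by
  intro _ _ ι _ P h
  obtain ⟨hli, hsp⟩ := h
  have b : Module.Basis ι ℤ (mordellWeilModTorsion W) := Module.Basis.mk hli hsp.ge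
  rw [← finrank_mordellWeilModTorsion_eq_holds W, Module.finrank_eq_card_basis b]

end Discharges

end WeierstrassCurve

end
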